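import Mathlib
import Literature.Computability.MetaComplexity.ACRearrangement
import HarnessLib

/-!
# Tree-like line complexity of associative–commutative rearrangement: the `Ω(N log N)` counting bound

The SEQUENTIAL / TREE-LIKE companion of the universe measure `ACRewriting.acUniverse` of
`ACRearrangement.lean`.  Sleator, Tarjan and Thurston (1992, Thm. 4.1) proved that some pair of
`n`-operand expressions over an associative, commutative operation are `Ω(n log n)` applications of
the two laws apart (twists and rotations of binary trees; the bound is tight, Culik–Wood), by a
counting argument: few short move sequences, `(n-1)!·…` many expressions.  Pudlák and Buss (1995, §4)
use the same skeleton-counting idea for Orevkov's lower bound on TREE-LIKE Frege proofs of the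
permutation tautologies.  This file formalises the counting bound for tree-like derivations in the
pure AC equational calculus on the right combs `combPerm π` of `ACRearrangement.lean`:

* `ACRewriting.TreeDerives s t k` — a tree-like derivation of `s = t` (reflexivity, symmetry,
  transitivity, commutativity and associativity instances, congruence) with exactly `k` LINES
  (nodes of the proof tree); `ACRewriting.treeLines π` — the least number of lines of a tree-like
  derivation of `combPerm 1 = combPerm π` (attained, `treeLines_spec`; every universe derivation
  `Derives Δ` unravels to a tree-like one, `exists_treeDerives_of_derives`).
* COMPILATION (`TreeDerives.exists_word`): a `k`-line tree-like derivation of `s = t` yields a word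
  of length `≤ 4k` over a seven-letter cursor alphabet (`TreeLike.Letter`: descend left/right,
  climb, commute / associate / associate back at the focus) driving a zipper machine
  (`TreeLike.step`, `TreeLike.exec`) that carries `s` to `t` in every context — symmetry runs the
  letterwise-inverted word backwards, congruence brackets the two sub-runs by descents and climbs.
* COUNTING (`factorial_le_pow_of_treeLines_le`): `combPerm` is injective (`combPerm_injective`), so
  if every rearrangement of `N = n + 1` summands has a tree-like derivation with `≤ L` lines then
  `N ! ≤ 8 ^ (4 L)`; with `(N/2)^(N/2) ≤ N !` this gives the bound of Sleator–Tarjan–Thurston shape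
  `treeLines_lower_bound : 4 ≤ n + 1 → ∃ π, (n + 1) · log₂ (n + 1) ≤ 72 · treeLines π` and its
  eventually-form `exists_perm_treeLines_superlinear` (`∃ C, ∀ᶠ n, ∃ π, (n+1) log₂ (n+1) ≤ C · treeLines π`).

Scope (honest): this is the tree-like LINE measure, where counting decides the question; it says
nothing about the dag-like universe measure `acUniverse` (subterm-closed universes of size `U`
number `2^{Θ(U log U)}`, so the same injection only gives `acUniverse π = Ω(N)`), which is the open
crux `ACRearrangementLowerBound` of the hub route `FregeLinesACUniverse` (sub-problem `PneNP`); the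
eventually-form below is that crux's statement with `treeLines` in place of `acUniverse` and serves
as its decided sibling-model rung.  Nothing here bears on P versus NP.

## Sources

* D. D. Sleator, R. E. Tarjan, W. P. Thurston, *Short encodings of evolving structures*, SIAM J.
  Discrete Math. 5 (1992) 428–450: §4 and Thm. 4.1 (part 2: some expression `E'` is `Ω(n log n)`
  applications of the commutative and associative laws away from `E`; proof by counting,
  `2n + 4m - 2 ≥ log₂ ((n-1)!·…)`).
* P. Pudlák, S. Buss, *How to lie without being (easily) convicted and the lengths of proofs in
  propositional calculus*, CSL '94, LNCS 933 (1995) 151–162, §4 (permutation tautologies; Orevkov's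
  `ε·n·log n` lower bound for tree-like proofs by counting proof skeletons).
* J. Krajíček, *Bounded Arithmetic, Propositional Logic, and Complexity Theory* (1995), §4.4
  (measures of complexity of proofs: number of lines / steps `k`, tree-like versus sequence-like).

## Design choices

* Terms are Mathlib's `FreeAddMagma α` as in `ACRearrangement.lean`; `TreeDerives` carries the line
  count as an index (no proof objects as data), so `treeLines` is an `sInf` over `ℕ` shown to be
  attained.  The cursor alphabet is a plain seven-constructor inductive WITHOUT derived instances
  (library lint: no instances in statement files); counting goes through the explicit injection
  `TreeLike.Letter.code : Letter → Fin 7`, so words inject into `Fin (4L) → Option (Fin 7)`.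
* Constants are explicit and unoptimised (`|word| ≤ 4·lines`, `N log₂ N ≤ 72·L` for `N ≥ 4`); the
  asymptotic content is Sleator–Tarjan–Thurston's `Θ(n log n)`, lower-bound half only.
* Mathlib has `FreeAddMagma`, `Equiv.Perm`, `Nat.log`, `Nat.factorial` bounds, but no rewriting
  derivations with a step count and no zipper machine on binary trees (searched `FreeMagma`,
  `Rewriting`, `zipper`, `rotation`).
-/

namespace Literature.Computability.MetaComplexity

namespace ACRewriting

open FreeAddMagma
open scoped Nat

universe u

variable {α : Type u}

/-! ## Tree-like AC derivations with a line count -/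

/-- `TreeDerives s t k`: a TREE-LIKE derivation of `s = t` in the pure associative–commutative
equational calculus with exactly `k` lines (nodes of the proof tree: reflexivity, symmetry,
transitivity, the commutativity and associativity axiom instances, congruence).
[cite: PudlakBuss1995, §4 (tree-like proofs of the permutation identities, counted by lines)]
[cite: Krajicek1995, §4.4 (the number of steps k; tree-like proofs)] -/
inductive TreeDerives : FreeAddMagma α → FreeAddMagma α → ℕ → Prop
  /-- reflexivity, one line -/
  | refl (t : FreeAddMagma α) : TreeDerives t t 1
  /-- symmetry, one more line -/
  | symm {s t : FreeAddMagma α} {k : ℕ} : TreeDerives s t k → TreeDerives t s (k + 1)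
  /-- transitivity, one more line -/
  | trans {s t u : FreeAddMagma α} {k m : ℕ} :
      TreeDerives s t k → TreeDerives t u m → TreeDerives s u (k + m + 1)
  /-- a commutativity instance, one line -/
  | comm (s t : FreeAddMagma α) : TreeDerives (s + t) (t + s) 1
  /-- an associativity instance, one line -/
  | assoc (s t u : FreeAddMagma α) : TreeDerives (s + t + u) (s + (t + u)) 1
  /-- congruence, one more line -/
  | cong {s₁ t₁ s₂ t₂ : FreeAddMagma α} {k m : ℕ} :
      TreeDerives s₁ t₁ k → TreeDerives s₂ t₂ m → TreeDerives (s₁ + s₂) (t₁ + t₂) (k + m + 1)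

/-- Every line count is positive. [cite: Krajicek1995, §4.4] -/
theorem TreeDerives.pos {s t : FreeAddMagma α} {k : ℕ} (h : TreeDerives s t k) : 0 < k := by
  cases h <;> omega

section Link

variable [DecidableEq α]

/-- Tree-like derivations derive AC-congruent terms (link with `ACRewriting.Congruent`).
[cite: Krajicek1995, Def 13.3.1 / §4.4] -/
theorem TreeDerives.congruent {s t : FreeAddMagma α} {k : ℕ} (h : TreeDerives s t k) :
    Congruent s t := by
  induction h with
  | refl t => exact Congruent.refl t
  | symm _ ih => exact ih.symm
  | trans _ _ ih₁ ih₂ => exact ih₁.trans ih₂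
  | comm s t => exact Congruent.comm s t
  | assoc s t u => exact Congruent.assoc s t u
  | cong _ _ ih₁ ih₂ => exact ih₁.add ih₂

end Link

/-- Every derivation inside a finite universe (`Derives Δ`, the dag-like / universe presentation)
unravels to a tree-like derivation with some number of lines. [cite: Krajicek1995, §4.4 (sequence-like versus tree-like proofs)] -/
theorem exists_treeDerives_of_derives {Δ : Finset (FreeAddMagma α)} {s t : FreeAddMagma α}
    (h : Derives Δ s t) : ∃ k, TreeDerives s t k := by
  induction h with
  | refl _ => exact ⟨1, .refl _⟩
  | symm _ ih =>
    obtain ⟨k, hk⟩ := ih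
    exact ⟨k + 1, hk.symm⟩
  | trans _ _ ih₁ ih₂ =>
    obtain ⟨k, hk⟩ := ih₁
    obtain ⟨m, hm⟩ := ih₂
    exact ⟨k + m + 1, hk.trans hm⟩
  | comm _ _ => exact ⟨1, .comm _ _⟩
  | assoc _ _ => exact ⟨1, .assoc _ _ _⟩
  | cong _ _ _ _ ih₁ ih₂ =>
    obtain ⟨k, hk⟩ := ih₁
    obtain ⟨m, hm⟩ := ih₂
    exact ⟨k + m + 1, hk.cong hm⟩

/-! ## The cursor machine: a zipper over binary trees driven by a seven-letter alphabet -/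

namespace TreeLike

/-- The cursor alphabet: descend to the left / right child, climb from a left / right child, and
the three rewrites at the focus (commute, associate, associate back) — twists and rotations made
local by a cursor. [cite: SleatorTarjanThurston1992, §4 (twists and rotations of binary trees)] -/
inductive Letter
  /-- descend to the left child -/
  | goL
  /-- descend to the right child -/
  | goR
  /-- climb from a left child -/
  | upL
  /-- climb from a right child -/
  | upR
  /-- commute at the focus (a twist) -/
  | com
  /-- associate `(x + y) + z ↦ x + (y + z)` at the focus (a rotation) -/
  | asc
  /-- associate back `x + (y + z) ↦ (x + y) + z` (the inverse rotation) -/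
  | ascInv

/-- Letterwise inverse (descents and climbs swap, the twist is an involution, the two rotations
swap). [cite: SleatorTarjanThurston1992, §4] -/
def Letter.inv : Letter → Letter
  | .goL => .upL
  | .goR => .upR
  | .upL => .goL
  | .upR => .goR
  | .com => .com
  | .asc => .ascInv
  | .ascInv => .asc

/-- An explicit coding of the seven letters by `Fin 7` (used for counting words; no instances are
declared on `Letter`). [cite: SleatorTarjanThurston1992, Thm 4.1 (encoding moves by a bounded alphabet)] -/
def Letter.code : Letter → Fin 7
  | .goL => 0
  | .goR => 1
  | .upL => 2
  | .upR => 3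
  | .com => 4
  | .asc => 5
  | .ascInv => 6

/-- The coding of letters is injective. [cite: SleatorTarjanThurston1992, Thm 4.1] -/
theorem Letter.code_injective : Function.Injective Letter.code := by
  intro a b h
  cases a <;> cases b <;> first | rfl | exact absurd h (by simp [Letter.code])

/-- Machine states: the focused subtree and the stack of frames above it (`false` = the focus is a
left child and the frame holds its right sibling; `true` = the focus is a right child).
[cite: SleatorTarjanThurston1992, §4] -/
abbrev St (α : Type u) := FreeAddMagma α × List (Bool × FreeAddMagma α)

/-- One step of the cursor machine (`none` = the letter does not apply in this state).
[cite: SleatorTarjanThurston1992, §4 (a twist = the commutative law, a rotation = the associative law)] -/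
def step : Letter → St α → Option (St α)
  | .goL, (t, ctx) =>
      match t with
      | .of _ => none
      | x + y => some (x, (false, y) :: ctx)
  | .goR, (t, ctx) =>
      match t with
      | .of _ => none
      | x + y => some (y, (true, x) :: ctx)
  | .upL, (t, ctx) =>
      match ctx with
      | (false, y) :: ctx => some (t + y, ctx)
      | _ => none
  | .upR, (t, ctx) =>
      match ctx with
      | (true, x) :: ctx => some (x + t, ctx)
      | _ => none
  | .com, (t, ctx) =>
      match t with
      | .of _ => none
      | x + y => some (y + x, ctx)
  | .asc, (t, ctx) =>
      match t with
      | x + y + z => some (x + (y + z), ctx)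
      | _ => none
  | .ascInv, (t, ctx) =>
      match t with
      | x + (y + z) => some (x + y + z, ctx)
      | _ => none

section StepLemmas

variable (x y z t : FreeAddMagma α) (a : α) (ctx : List (Bool × FreeAddMagma α))

/-- `goL` on a sum. [folklore] -/
@[simp] private theorem step_goL_add : step .goL (x + y, ctx) = some (x, (false, y) :: ctx) := rfl
/-- `goL` on a leaf. [folklore] -/
@[simp] private theorem step_goL_of : step .goL (FreeAddMagma.of a, ctx) = none := rfl
/-- `goR` on a sum. [folklore] -/
@[simp] private theorem step_goR_add : step .goR (x + y, ctx) = some (y, (true, x) :: ctx) := rfl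
/-- `goR` on a leaf. [folklore] -/
@[simp] private theorem step_goR_of : step .goR (FreeAddMagma.of a, ctx) = none := rfl
/-- `upL` from a left child. [folklore] -/
@[simp] private theorem step_upL_false : step .upL (t, (false, y) :: ctx) = some (t + y, ctx) := rfl
/-- `upL` from a right child fails. [folklore] -/
@[simp] private theorem step_upL_true : step .upL (t, (true, y) :: ctx) = none := rfl
/-- `upL` at the root fails. [folklore] -/
@[simp] private theorem step_upL_nil : step .upL (t, ([] : List (Bool × FreeAddMagma α))) = none := rfl
/-- `upR` from a right child. [folklore] -/
@[simp] private theorem step_upR_true : step .upR (t, (true, x) :: ctx) = some (x + t, ctx) := rfl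
/-- `upR` from a left child fails. [folklore] -/
@[simp] private theorem step_upR_false : step .upR (t, (false, x) :: ctx) = none := rfl
/-- `upR` at the root fails. [folklore] -/
@[simp] private theorem step_upR_nil : step .upR (t, ([] : List (Bool × FreeAddMagma α))) = none := rfl
/-- `com` on a sum. [folklore] -/
@[simp] private theorem step_com_add : step .com (x + y, ctx) = some (y + x, ctx) := rfl
/-- `com` on a leaf fails. [folklore] -/
@[simp] private theorem step_com_of : step .com (FreeAddMagma.of a, ctx) = none := rfl
/-- `asc` on a left-nested sum. [folklore] -/
@[simp] private theorem step_asc_add_add : step .asc (x + y + z, ctx) = some (x + (y + z), ctx) := rfl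
/-- `asc` fails when the left child is a leaf. [folklore] -/
@[simp] private theorem step_asc_of_add : step .asc (FreeAddMagma.of a + z, ctx) = none := rfl
/-- `asc` on a leaf fails. [folklore] -/
@[simp] private theorem step_asc_of : step .asc (FreeAddMagma.of a, ctx) = none := rfl
/-- `ascInv` on a right-nested sum. [folklore] -/
@[simp] private theorem step_ascInv_add_add :
    step .ascInv (x + (y + z), ctx) = some (x + y + z, ctx) := rfl
/-- `ascInv` fails when the right child is a leaf. [folklore] -/
@[simp] private theorem step_ascInv_add_of : step .ascInv (x + FreeAddMagma.of a, ctx) = none := rfl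
/-- `ascInv` on a leaf fails. [folklore] -/
@[simp] private theorem step_ascInv_of : step .ascInv (FreeAddMagma.of a, ctx) = none := rfl

end StepLemmas

/-- Each letter is undone by its inverse letter. [cite: SleatorTarjanThurston1992, §4 (moves are reversible)] -/
theorem step_inv {l : Letter} {st st' : St α} (h : step l st = some st') :
    step l.inv st' = some st := by
  obtain ⟨t, ctx⟩ := st
  cases l with
  | goL =>
    cases t with
    | of a => simp at h
    | add x y =>
      simp at h
      subst h
      rfl
  | goR =>
    cases t with
    | of a => simp at h
    | add x y =>
      simp at h
      subst h
      rfl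
  | upL =>
    cases ctx with
    | nil => simp at h
    | cons f ctx =>
      obtain ⟨b, y⟩ := f
      cases b with
      | true => simp at h
      | false =>
        simp at h
        subst h
        rfl
  | upR =>
    cases ctx with
    | nil => simp at h
    | cons f ctx =>
      obtain ⟨b, x⟩ := f
      cases b with
      | false => simp at h
      | true =>
        simp at h
        subst h
        rfl
  | com =>
    cases t with
    | of a => simp at h
    | add x y =>
      simp at h
      subst h
      rfl
  | asc =>
    cases t with
    | of a => simp at h
    | add s z =>
      cases s with
      | of a => simp at h
      | add x y =>
        simp at h
        subst h
        rfl
  | ascInv =>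
    cases t with
    | of a => simp at h
    | add x s =>
      cases s with
      | of a => simp at h
      | add y z =>
        simp at h
        subst h
        rfl

/-- Running a word on the cursor machine. [cite: SleatorTarjanThurston1992, §4] -/
def exec : List Letter → St α → Option (St α)
  | [], st => some st
  | l :: w, st => (step l st).bind (exec w)

/-- The empty word does nothing. [folklore] -/
@[simp] private theorem exec_nil (st : St α) : exec [] st = some st := rfl

/-- Unfolding one letter. [folklore] -/
@[simp] private theorem exec_cons (l : Letter) (w : List Letter) (st : St α) :
    exec (l :: w) st = (step l st).bind (exec w) := rfl

/-- Running a concatenation. [folklore] -/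
private theorem exec_append (w₁ w₂ : List Letter) (st : St α) :
    exec (w₁ ++ w₂) st = (exec w₁ st).bind (exec w₂) := by
  induction w₁ generalizing st with
  | nil => rfl
  | cons l w ih =>
    rw [List.cons_append, exec_cons, exec_cons]
    cases step l st with
    | none => rfl
    | some st₁ => exact ih st₁

/-- Running the letterwise-inverted word backwards undoes a run.
[cite: SleatorTarjanThurston1992, §4 (moves are reversible)] -/
theorem exec_inv {w : List Letter} {st st' : St α} (h : exec w st = some st') :
    exec (w.map Letter.inv).reverse st' = some st := by
  induction w generalizing st with
  | nil =>
    simp at h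
    subst h
    rfl
  | cons l w ih =>
    rw [exec_cons] at h
    cases hst : step l st with
    | none => rw [hst] at h; exact absurd h (by simp)
    | some st₁ =>
      rw [hst] at h
      have h' : exec w st₁ = some st' := h
      rw [List.map_cons, List.reverse_cons, exec_append, ih h']
      show exec [l.inv] st₁ = some st
      rw [exec_cons, step_inv hst]
      rfl

end TreeLike

open TreeLike

/-- COMPILATION: a `k`-line tree-like derivation of `s = t` yields a cursor word of length `≤ 4k`
carrying `s` to `t` in every context (symmetry = the inverted word backwards; transitivity =
concatenation; congruence = descend left, run, climb, descend right, run, climb).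
[cite: PudlakBuss1995, §4 (a tree-like proof is determined by a short skeleton)]
[cite: SleatorTarjanThurston1992, Thm 4.1 (part 1: expressions reachable in m moves are encodable in O(n + m) bits)] -/
theorem TreeDerives.exists_word {s t : FreeAddMagma α} {k : ℕ} (h : TreeDerives s t k) :
    ∃ w : List Letter, w.length ≤ 4 * k ∧
      ∀ ctx : List (Bool × FreeAddMagma α), exec w (s, ctx) = some (t, ctx) := by
  induction h with
  | refl t => exact ⟨[], by simp, fun ctx => rfl⟩
  | symm _ ih =>
    obtain ⟨w, hw, he⟩ := ih
    refine ⟨(w.map Letter.inv).reverse, ?_, fun ctx => exec_inv (he ctx)⟩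
    simp only [List.length_reverse, List.length_map]
    omega
  | trans _ _ ih₁ ih₂ =>
    obtain ⟨w₁, hw₁, he₁⟩ := ih₁
    obtain ⟨w₂, hw₂, he₂⟩ := ih₂
    refine ⟨w₁ ++ w₂, ?_, fun ctx => ?_⟩
    · simp only [List.length_append]
      omega
    · rw [exec_append, he₁ ctx]
      exact he₂ ctx
  | comm s t => exact ⟨[.com], by simp, fun ctx => rfl⟩
  | assoc s t u => exact ⟨[.asc], by simp, fun ctx => rfl⟩
  | cong _ _ ih₁ ih₂ =>
    obtain ⟨w₁, hw₁, he₁⟩ := ih₁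
    obtain ⟨w₂, hw₂, he₂⟩ := ih₂
    refine ⟨(.goL :: w₁) ++ (.upL :: .goR :: w₂) ++ [.upR], ?_, fun ctx => ?_⟩
    · simp only [List.length_append, List.length_cons, List.length_nil]
      omega
    · rw [exec_append, exec_append]
      simp [he₁, he₂]

/-! ## Leaf words: `combPerm` is injective -/

/-- The leaf word of a term (its frontier, read left to right). [folklore] -/
def leafWord : FreeAddMagma α → List α
  | .of a => [a]
  | x + y => leafWord x ++ leafWord y

/-- Leaf word of a leaf. [folklore] -/
@[simp] private theorem leafWord_of (a : α) : leafWord (FreeAddMagma.of a) = [a] := rfl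

/-- Leaf word of a sum. [folklore] -/
@[simp] private theorem leafWord_add (x y : FreeAddMagma α) :
    leafWord (x + y) = leafWord x ++ leafWord y := rfl

section Combs

variable [DecidableEq α]

omit [DecidableEq α] in
/-- Leaf word of a right comb. [folklore] -/
private theorem leafWord_comb (l : List α) (z : FreeAddMagma α) :
    leafWord (comb l z) = l ++ leafWord z := by
  induction l with
  | nil => rfl
  | cons a l ih => simp [ih]

variable {n : ℕ}

/-- The leaf word of `combPerm π` lists `π`. [cite: PudlakBuss1995, §4] -/
theorem leafWord_combPerm (π : Equiv.Perm (Fin (n + 1))) :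
    leafWord (combPerm π) = List.ofFn ⇑π := by
  rw [List.ofFn_succ' (f := ⇑π)]
  simp [combPerm, leafWord_comb]

/-- Different permutations have different combs. [cite: PudlakBuss1995, §4] -/
theorem combPerm_injective :
    Function.Injective (combPerm : Equiv.Perm (Fin (n + 1)) → FreeAddMagma (Fin (n + 1))) := by
  intro π σ h
  have h' := congrArg leafWord h
  rw [leafWord_combPerm, leafWord_combPerm] at h'
  exact Equiv.ext fun i => congrFun (List.ofFn_injective h') i

/-! ## Tree-like line complexity of a rearrangement and the counting bound -/

/-- `treeLines π`: the least number of LINES of a tree-like AC derivation of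
`x₀ + (x₁ + ⋯) = x_{π 0} + (x_{π 1} + ⋯)` — the tree-like-lines companion of `acUniverse π`.
[cite: PudlakBuss1995, §4 (number of steps of tree-like proofs of the permutation identities)]
[cite: SleatorTarjanThurston1992, §4 (the distance d_n between two n-operand expressions)] -/
noncomputable def treeLines (π : Equiv.Perm (Fin (n + 1))) : ℕ :=
  sInf {k | TreeDerives (combPerm 1) (combPerm π) k}

/-- `treeLines π` is attained (the `sInf` is never the junk value `0`). [cite: PudlakBuss1995, §4] -/
theorem treeLines_spec (π : Equiv.Perm (Fin (n + 1))) :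
    TreeDerives (combPerm 1) (combPerm π) (treeLines π) := by
  obtain ⟨Δ, _, _, hd⟩ := exists_card_eq_acUniverse π
  obtain ⟨k, hk⟩ := exists_treeDerives_of_derives hd
  exact Nat.sInf_mem ⟨k, hk⟩

/-- `treeLines π` is a lower bound for every tree-like derivation. [cite: PudlakBuss1995, §4] -/
theorem treeLines_le {π : Equiv.Perm (Fin (n + 1))} {k : ℕ}
    (h : TreeDerives (combPerm 1) (combPerm π) k) : treeLines π ≤ k :=
  Nat.sInf_le h

/-- `treeLines π` is positive. [cite: PudlakBuss1995, §4] -/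
theorem treeLines_pos (π : Equiv.Perm (Fin (n + 1))) : 0 < treeLines π :=
  (treeLines_spec π).pos

/-- COUNTING: if every rearrangement of `N = n + 1` summands has a tree-like derivation with `≤ L`
lines, then `N ! ≤ 8 ^ (4 L)` (permutations inject into padded cursor words over seven letters).
[cite: SleatorTarjanThurston1992, Thm 4.1 (part 2: (n-1)!·… expressions versus 2^(2n+4m-2) codes)] -/
theorem factorial_le_pow_of_treeLines_le {L : ℕ}
    (hL : ∀ σ : Equiv.Perm (Fin (n + 1)), treeLines σ ≤ L) : (n + 1)! ≤ 8 ^ (4 * L) := by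
  have key : ∀ σ : Equiv.Perm (Fin (n + 1)), ∃ w : List Letter,
      w.length ≤ 4 * L ∧ exec w (combPerm 1, []) = some (combPerm σ, []) := by
    intro σ
    obtain ⟨w, hw, he⟩ := (treeLines_spec σ).exists_word
    exact ⟨w, hw.trans (Nat.mul_le_mul_left 4 (hL σ)), he []⟩
  choose w hw he using key
  have hf : Function.Injective (fun (σ : Equiv.Perm (Fin (n + 1))) (i : Fin (4 * L)) =>
      ((w σ)[(i : ℕ)]?).map Letter.code) := by
    intro σ τ hστ
    have hwe : w σ = w τ := by
      refine List.ext_getElem? fun i => ?_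
      by_cases hi : i < 4 * L
      · exact Option.map_injective Letter.code_injective (congrFun hστ ⟨i, hi⟩)
      · have h₁ := hw σ
        have h₂ := hw τ
        rw [List.getElem?_eq_none_iff.2 (by omega), List.getElem?_eq_none_iff.2 (by omega)]
    have h2 := he τ
    rw [← hwe, he σ] at h2
    exact combPerm_injective (by simpa using h2)
  have hcard := Fintype.card_le_of_injective _ hf
  simpa [Fintype.card_perm, Fintype.card_fun, Fintype.card_fin, Fintype.card_option] using hcard

end Combs

/-! ## Arithmetic: from `N ! ≤ 8 ^ (4 L)` to `N log₂ N ≤ 72 L` -/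

/-- `(m+1)^k · m! ≤ (m+k)!`. [folklore] -/
private theorem pow_mul_factorial_le (m : ℕ) : ∀ k : ℕ, (m + 1) ^ k * m ! ≤ (m + k)!
  | 0 => by simp
  | k + 1 => by
    rw [pow_succ, ← Nat.add_assoc m k 1, Nat.factorial_succ]
    calc (m + 1) ^ k * (m + 1) * m ! = (m + 1) * ((m + 1) ^ k * m !) := by ring
      _ ≤ (m + k + 1) * (m + k)! := Nat.mul_le_mul (by omega) (pow_mul_factorial_le m k)

/-- `(N/2)^(N/2) ≤ N!`. [folklore] -/
private theorem half_pow_half_le_factorial (N : ℕ) : (N / 2) ^ (N / 2) ≤ N ! := by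
  have h := pow_mul_factorial_le (N - N / 2) (N / 2)
  have e : N - N / 2 + N / 2 = N := by omega
  rw [e] at h
  calc (N / 2) ^ (N / 2) ≤ (N - N / 2 + 1) ^ (N / 2) := Nat.pow_le_pow_left (by omega) _
    _ ≤ (N - N / 2 + 1) ^ (N / 2) * (N - N / 2)! :=
        Nat.le_mul_of_pos_right _ (Nat.factorial_pos _)
    _ ≤ N ! := h

/-- `2^(log₂ N - 1) ≤ N/2` for `N ≥ 2`. [folklore] -/
private theorem two_pow_log_pred_le_half (N : ℕ) (hN : 2 ≤ N) : 2 ^ (Nat.log 2 N - 1) ≤ N / 2 := by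
  have h1 : 1 ≤ Nat.log 2 N := Nat.log_pos (by norm_num) hN
  have h2 : 2 ^ Nat.log 2 N ≤ N := Nat.pow_log_le_self 2 (by omega)
  rw [Nat.le_div_iff_mul_le (by norm_num)]
  calc 2 ^ (Nat.log 2 N - 1) * 2 = 2 ^ (Nat.log 2 N - 1 + 1) := (pow_succ _ _).symm
    _ = 2 ^ Nat.log 2 N := by rw [Nat.sub_add_cancel h1]
    _ ≤ N := h2

/-- From `N ! ≤ 8 ^ (4 L)` to `N · log₂ N ≤ 72 · L` for `N ≥ 4`.
[cite: SleatorTarjanThurston1992, Thm 4.1 (2n + 4m - 2 = Ω(n log n) ⇒ m = Ω(n log n))] -/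
theorem arith_of_factorial_le_pow {N L : ℕ} (hN : 4 ≤ N) (h : N ! ≤ 8 ^ (4 * L)) :
    N * Nat.log 2 N ≤ 72 * L := by
  have h8 : (8 : ℕ) ^ (4 * L) = 2 ^ (12 * L) := by
    rw [show (8 : ℕ) = 2 ^ 3 by norm_num, ← pow_mul]
    ring_nf
  have hlog2 : 2 ≤ Nat.log 2 N :=
    Nat.le_log_of_pow_le (by norm_num) (by norm_num; omega)
  have h3 : 2 ^ ((Nat.log 2 N - 1) * (N / 2)) ≤ 2 ^ (12 * L) :=
    calc 2 ^ ((Nat.log 2 N - 1) * (N / 2)) = (2 ^ (Nat.log 2 N - 1)) ^ (N / 2) := pow_mul _ _ _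
      _ ≤ (N / 2) ^ (N / 2) := Nat.pow_le_pow_left (two_pow_log_pred_le_half N (by omega)) _
      _ ≤ N ! := half_pow_half_le_factorial N
      _ ≤ 8 ^ (4 * L) := h
      _ = 2 ^ (12 * L) := h8
  have h4 : (Nat.log 2 N - 1) * (N / 2) ≤ 12 * L :=
    (Nat.pow_le_pow_iff_right (by norm_num)).1 h3
  obtain ⟨g, hg⟩ : ∃ g, Nat.log 2 N = g + 2 := ⟨Nat.log 2 N - 2, by omega⟩
  rw [hg] at h4 ⊢
  have h5 : g + 2 - 1 = g + 1 := by omega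
  rw [h5] at h4
  have h6 : N ≤ 2 * (N / 2) + 1 := by omega
  have h7 : 2 ≤ N / 2 := by omega
  nlinarith [h4, h6, h7, Nat.mul_le_mul_right (g + 2) h6, Nat.mul_le_mul_right g h7]

/-! ## The lower bound -/

section LowerBound

variable {n : ℕ}

/-- **Tree-like AC rearrangement needs `Ω(N log N)` lines** (Sleator–Tarjan–Thurston shape, explicit
constant): for every `N = n + 1 ≥ 4` some rearrangement `π` of `N` summands satisfies
`N · log₂ N ≤ 72 · treeLines π` — every tree-like derivation of
`x₀ + (x₁ + ⋯) = x_{π 0} + (x_{π 1} + ⋯)` in the pure AC equational calculus has at least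
`N log₂ N / 72` lines.  Counting: `N ! ≤ 8 ^ (4 · max_π treeLines π)`.
[cite: SleatorTarjanThurston1992, Thm 4.1 (part 2: some expression is Ω(n log n) applications of the commutative and associative laws away)]
[cite: PudlakBuss1995, §4 (Orevkov's ε·n·log n bound for tree-like proofs by counting skeletons)] -/
theorem treeLines_lower_bound (hn : 4 ≤ n + 1) :
    ∃ π : Equiv.Perm (Fin (n + 1)), (n + 1) * Nat.log 2 (n + 1) ≤ 72 * treeLines π := by
  obtain ⟨π, -, hπ⟩ := Finset.exists_max_image (Finset.univ : Finset (Equiv.Perm (Fin (n + 1))))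
    treeLines Finset.univ_nonempty
  exact ⟨π, arith_of_factorial_le_pow hn
    (factorial_le_pow_of_treeLines_le fun σ => hπ σ (Finset.mem_univ σ))⟩

/-- **Eventually-form** (the statement of the hub crux `ACRearrangementLowerBound` with the tree-like
line measure `treeLines` in place of the dag-like universe measure `acUniverse`): there is a
constant `C` (here `72`) such that for all large `n` some rearrangement `π` of `Fin (n + 1)` has
`(n + 1) · log₂ (n + 1) ≤ C · treeLines π`.  Decided by counting; the universe version is open.
[cite: SleatorTarjanThurston1992, Thm 4.1 (part 2)] [cite: PudlakBuss1995, §4] -/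
theorem exists_perm_treeLines_superlinear :
    ∃ C : ℕ, ∀ᶠ n : ℕ in Filter.atTop, ∃ π : Equiv.Perm (Fin (n + 1)),
      (n + 1) * Nat.log 2 (n + 1) ≤ C * treeLines π :=
  ⟨72, Filter.eventually_atTop.2 ⟨3, fun _ hn => treeLines_lower_bound (by omega)⟩⟩

end LowerBound

end ACRewriting

end Literature.Computability.MetaComplexity
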